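import Summits.ValiantsHypothesis.ValiantsHypothesis.Theorems.KPlusLogSqLawStaticPathRecords
import Summits.ValiantsHypothesis.ValiantsHypothesis.Theorems.KPlusLogSqLawStaticPathCountLocal

/-!
# Route «KPlusLogSqLaw» — parametric max-weight independent set on a path: the ORDER LEMMA

HONEST FRAMING.  Helper toward the crux `WeakLifting` (item `stmt-ValiantsHypothesis-19561`, route `KPlusLogSqLaw`, cell `pub-symmetroid`,
seat val-sym-lift-p4 g8, 2026-08-27) on the line of its witness-plan stub `stub_tridiagonalSectorB` (tropical twin of the STATIC tridiagonal
sector = parametric maximum-weight independent set on a path; located theory `HOME/val-sym-lift-p4/LINEAR-LAW.md`).  Sequel of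
`KPlusLogSqLawStaticPathRecords.lean` (uncovered positions of the unique optimum = common touch points of the two alternating folds of the
signed prefix-sum lines).  Here: (1) the ACTIVE INDEX of an alternating fold — hence its set of touch points — depends only on the ORDER of the
line values (`lab_eq_of_order`, `fold_eq_L_iff_of_order`); (2) the prefix-sum lines of the reversed block are `(-1)^(n+1)` times differences
of the prefix-sum lines of the block (`L_rev_sub`, from val-sym-lift-p3 g6's `altA_shift_sub` / `altA_rev_sub`), so their order is read off
the order of the latter (`order_rev_of_order`); (3) the ORDER LEMMA (LINEAR-LAW Lemma 3.1, there checked numerically on 1 200+ instances by two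
seats): if the prefix-sum lines `S_0, …, S_n` compare the same way at two parameters and the optima there are unique, the optimal independent
sets coincide (`eq_of_order`) — the parametric problem lives on the allowable sequence of the arrangement `S_0, …, S_n`.
Statements about a path DP; nothing here asserts anything about `WeakLifting`, `TropicalB`, `KPlusLogSqLaw`, the stub in its window,
`MatrixDescartes` (stmt-ValiantsHypothesis-18050) or `VP ≠ VNP`.
-/

set_option linter.dupNamespace false
set_option autoImplicit false

namespace Summit.ValiantsHypothesis.ValiantsHypothesis.Theorems.KPlusLogSqLaw

open Finset Classical

namespace StaticPathFold

noncomputable section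

variable (w₁ w₀ : ℕ → ℝ)

/-! ## 1. Order-invariance of the active index and of the touch points -/

/-- **the active index of an alternating fold depends only on the ORDER of the line values**: if the lines `L 0, …, L n` compare the same way
at `θ` and at `θ'`, the active indices agree at every level `k ≤ n`. [folklore] -/
theorem lab_eq_of_order (a b : ℕ → ℝ) {n : ℕ} {θ θ' : ℝ}
    (hord : ∀ p q, p ≤ n → q ≤ n → (L a b p θ < L a b q θ ↔ L a b p θ' < L a b q θ')) :
    ∀ k, k ≤ n → lab a b k θ = lab a b k θ' := by
  -- `≤` transfers as well
  have hle : ∀ p q, p ≤ n → q ≤ n → (L a b p θ ≤ L a b q θ ↔ L a b p θ' ≤ L a b q θ') := by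
    intro p q hp hq
    rw [← not_lt, ← not_lt, hord q p hq hp]
  intro k
  induction k with
  | zero =>
    intro _
    simp [lab]
  | succ k ih =>
    intro hk
    have ihk := ih (by omega)
    -- the fold at level `k` is the line of the (common) active index `j`
    have hj := fold_eq_lab a b k θ
    have hj' := fold_eq_lab a b k θ'
    rw [← ihk] at hj'
    have hjle : lab a b k θ ≤ n := (lab_le a b k θ).trans (by omega)
    -- the touch test at level `k+1` reads the same at `θ` and `θ'`
    have htouch : fold a b (k + 1) θ = L a b (k + 1) θ ↔ fold a b (k + 1) θ' = L a b (k + 1) θ' := by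
      rw [fold_succ, fold_succ, hj, hj']
      split_ifs with he
      · rw [min_eq_left_iff, min_eq_left_iff]
        exact hle (k + 1) _ hk hjle
      · rw [max_eq_left_iff, max_eq_left_iff]
        exact hle _ (k + 1) hjle hk
    show Nat.findGreatest (fun j => fold a b j θ = L a b j θ) (k + 1) =
      Nat.findGreatest (fun j => fold a b j θ' = L a b j θ') (k + 1)
    rw [Nat.findGreatest_succ, Nat.findGreatest_succ]
    by_cases h : fold a b (k + 1) θ = L a b (k + 1) θ
    · rw [if_pos h, if_pos (htouch.mp h)]
    · rw [if_neg h, if_neg (fun h' => h (htouch.mpr h'))]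
      exact ihk

/-- hence **the touch points (records) of an alternating fold depend only on the order of the line values**. [folklore] -/
theorem fold_eq_L_iff_of_order (a b : ℕ → ℝ) {n : ℕ} {θ θ' : ℝ}
    (hord : ∀ p q, p ≤ n → q ≤ n → (L a b p θ < L a b q θ ↔ L a b p θ' < L a b q θ')) {k : ℕ} (hk : k ≤ n) :
    fold a b k θ = L a b k θ ↔ fold a b k θ' = L a b k θ' := by
  rw [fold_eq_L_iff_lab, fold_eq_L_iff_lab, lab_eq_of_order a b hord k hk]

/-- **the prefix-sum lines of the REVERSED block are, up to the sign `(-1)^(n+1)`, differences of the prefix-sum lines of the block**: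
for `p, q ≤ n`, `S'_q - S'_p = (-1)^(n+1) · (S_(n-p) - S_(n-q))` (both are `±` the same global alternating interval sum,
`altA_shift_sub` / `altA_rev_sub`). [folklore] -/
theorem L_rev_sub {i n p q : ℕ} (hp : p ≤ n) (hq : q ≤ n) (θ : ℝ) :
    L (altA (shift 0 (rev i n w₁))) (altB (shift 0 (rev i n w₀))) q θ - L (altA (shift 0 (rev i n w₁))) (altB (shift 0 (rev i n w₀))) p θ =
      (-1) ^ (n + 1) * (L (altA (shift i w₁)) (altB (shift i w₀)) (n - p) θ - L (altA (shift i w₁)) (altB (shift i w₀)) (n - q) θ) := by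
  -- reduce to `p ≤ q`
  wlog hpq : p ≤ q generalizing p q
  · have h := this hq hp (not_le.mp hpq).le
    linear_combination (-1 : ℝ) * h
  have hA := altA_rev_sub w₁ i n p q hpq hq
  have hB := altB_rev_sub w₀ i n p q hpq hq
  have hA' := altA_shift_sub w₁ i (n - q) (n - p) (by omega)
  have hB' := altB_shift_sub w₀ i (n - q) (n - p) (by omega)
  rw [show i + (n - q) = i + n - q by omega, show i + (n - p) = i + n - p by omega] at hA' hB'
  have hsign : ((-1 : ℝ)) ^ (i + n + 1) = (-1) ^ (n + 1) * (-1) ^ i := by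
    rw [← pow_add]; congr 1; omega
  unfold L
  rw [hsign, mul_assoc, ← hA'] at hA
  rw [hsign, mul_assoc, ← hB'] at hB
  linear_combination θ * hA + hB

/-- **the order of the reversed block's prefix-sum lines is read off the order of the block's prefix-sum lines**. [folklore] -/
theorem order_rev_of_order {i n : ℕ} {θ θ' : ℝ}
    (hord : ∀ p q, p ≤ n → q ≤ n → (L (altA (shift i w₁)) (altB (shift i w₀)) p θ < L (altA (shift i w₁)) (altB (shift i w₀)) q θ ↔
      L (altA (shift i w₁)) (altB (shift i w₀)) p θ' < L (altA (shift i w₁)) (altB (shift i w₀)) q θ')) :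
    ∀ p q, p ≤ n → q ≤ n →
      (L (altA (shift 0 (rev i n w₁))) (altB (shift 0 (rev i n w₀))) p θ < L (altA (shift 0 (rev i n w₁))) (altB (shift 0 (rev i n w₀))) q θ ↔
        L (altA (shift 0 (rev i n w₁))) (altB (shift 0 (rev i n w₀))) p θ' <
          L (altA (shift 0 (rev i n w₁))) (altB (shift 0 (rev i n w₀))) q θ') := by
  intro p q hp hq
  have key : ∀ τ : ℝ,
      (L (altA (shift 0 (rev i n w₁))) (altB (shift 0 (rev i n w₀))) p τ < L (altA (shift 0 (rev i n w₁))) (altB (shift 0 (rev i n w₀))) q τ ↔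
        0 < (-1) ^ (n + 1) * (L (altA (shift i w₁)) (altB (shift i w₀)) (n - p) τ - L (altA (shift i w₁)) (altB (shift i w₀)) (n - q) τ)) :=
    fun τ => by rw [← sub_pos, L_rev_sub w₁ w₀ (i := i) hp hq τ]
  rw [key θ, key θ']
  rcases Nat.even_or_odd (n + 1) with he | ho
  · rw [Even.neg_one_pow he, one_mul, one_mul, sub_pos, sub_pos]
    exact hord _ _ (Nat.sub_le n q) (Nat.sub_le n p)
  · rw [Odd.neg_one_pow ho, neg_one_mul, neg_one_mul, neg_pos, neg_pos, sub_neg, sub_neg]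
    exact hord _ _ (Nat.sub_le n p) (Nat.sub_le n q)

/-- **ORDER LEMMA** (LINEAR-LAW Lemma 3.1, kernel form): if the signed prefix-sum lines `S_0, …, S_n` of the block `i+1, …, i+n` compare the same
way at `θ` and at `θ'`, and the block has unique maximisers `M` at `θ` and `M'` at `θ'`, then `M = M'` — the optimal independent set depends only
on the ORDER of the prefix-sum values (so the parametric problem lives on the allowable sequence of the line arrangement). [folklore] -/
theorem eq_of_order {i n : ℕ} {θ θ' : ℝ} {M M' : Finset ℕ} (hM : M ∈ indepSets i n) (hM' : M' ∈ indepSets i n)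
    (huniq : ∀ S ∈ indepSets i n, S ≠ M → ∑ t ∈ S, W w₁ w₀ t θ < ∑ t ∈ M, W w₁ w₀ t θ)
    (huniq' : ∀ S ∈ indepSets i n, S ≠ M' → ∑ t ∈ S, W w₁ w₀ t θ' < ∑ t ∈ M', W w₁ w₀ t θ')
    (hord : ∀ p q, p ≤ n → q ≤ n → (L (altA (shift i w₁)) (altB (shift i w₀)) p θ < L (altA (shift i w₁)) (altB (shift i w₀)) q θ ↔
      L (altA (shift i w₁)) (altB (shift i w₀)) p θ' < L (altA (shift i w₁)) (altB (shift i w₀)) q θ')) : M = M' := by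
  refine eq_of_avoid_iff hM hM' fun x hx => ?_
  rw [avoid_iff_folds_of_unique w₁ w₀ hM huniq hx, avoid_iff_folds_of_unique w₁ w₀ hM' huniq' hx,
    fold_eq_L_iff_of_order _ _ hord hx, fold_eq_L_iff_of_order _ _ (order_rev_of_order w₁ w₀ hord) (Nat.sub_le n x)]

end

end StaticPathFold

end Summit.ValiantsHypothesis.ValiantsHypothesis.Theorems.KPlusLogSqLaw
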